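import Mathlib.Algebra.BigOperators.Ring.Finset
import Mathlib.Algebra.BigOperators.Group.Finset.Sigma
import Mathlib.Algebra.Order.BigOperators.Group.Finset
import Mathlib.Algebra.Order.Field.Basic
import Mathlib.Data.Real.Basic
import Mathlib.Tactic.Positivity
import Mathlib.Tactic.Ring
import Mathlib.Tactic.Linarith
import HarnessLib

/-!
# `UV3BranchExpansionCountingAmortizedLetters` — letters for the AMORTIZED COVERING INEQUALITY of the branch (Möbius) expansion of the
# guarded averaging: crossing bonds, side slots, read sets, and two powerset identities (crux `UnitScaleTilt.HistoryTailL`,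
# stmt-QuantumFields-19936 — SUPPLY side, record-independent finite combinatorics)

Cell `ym3-torus` (YM ladder rung R3 = continuum SU(2) Yang–Mills on T³ — a RUNG, NOT d = 4, NOT infinite volume, NOT a mass gap, NOT Clay);
width seat `ym-ust-19936-w2` (gen 17), explicit-unit helper; `--supports stmt-QuantumFields-19936 --as helper`.  THEOREMS ONLY (0 `def`,
0 `sorry`, default heartbeats, Mathlib + HarnessLib imports only).

WHAT.  The abstract one-step blocking geometry used by the amortized covering inequality (sequel file
`UV3BranchExpansionCountingAmortizedStep`; LEAD ★w1-19936 g12's note `Cruxes/HistoryTailL/HTopBranchExpansion.md` §5, repaired after the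
shared-reader finding of 2026-08-30): two finite bond types `β` (upper level) and `γ` (the level below); for each upper bond `g` a read set
`R g : Finset γ`, a straight segment `line g : Finset γ` of exactly `L` bonds, pairwise disjoint, with a distinguished crossing bond
`ctr g ∈ line g` that is PRIVATE (`ctr g ∈ R c → c = g`); `|R c| ≤ r₀`; every lower bond is read by at most `ρ₀` upper bonds.  The side slots of
`g` are `line g ∖ {ctr g}`.

* §1 ★ `ctr_injective`, `card_image_ctr` (`|ctr(G)| = |G|`), `card_biUnion_side` (`|Side(G)| = (L−1)|G|`), `disjoint_image_ctr_biUnion_side`,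
  `biUnion_line_eq` (`line(G) = ctr(G) ⊔ Side(G)`), ★ `ctr_not_mem_biUnion_R` (PRIVACY: the crossing bond of a segment that does not fire is read
  by no fired bond), `card_biUnion_R_le` (`|R(s)| ≤ r₀|s|`), ★ `card_N_le` (the readers of the side slots of `G`: `|N(G)| ≤ (L−1)ρ₀|G|`, `N`
  hypothesis-specified by `hN`).
* §2 `sum_powerset_pow_card` (`Σ_{T⊆S} D^{|T|} = (1+D)^{|S|}`), `sum_powerset_pow_sdiff_mul_pow` (`Σ_{T⊆S} y^{|S∖T|}D^{|T|} = (y+D)^{|S|}`), and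
  ★★ `sum_explored_le`: `Σ_{ctr(G) ⊆ X' ⊆ line(G) ∪ Rs} y^{|Side G ∖ X'|}·D^{|X'|} ≤ D^{|G|}·(y + D)^{(L−1)|G|}·(1 + D)^{|Rs|}` — the crossing slots
  of explored ghosts are distorted (`D` each), each side slot is distorted (`D`) or penalised (`y`), each read bond distorted or not — via the
  injection `X' ↦ (X' ∩ Side G, X' ∖ line G)` into `𝒫(Side G) × 𝒫(Rs)`.

HONEST SCOPE.  [folklore] finite combinatorics; the model's letters (`PBond`, the (0.4) guard's read sets, `r₀`, `ρ₀`) are NOT instantiated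
here.  Nothing of hTop, the χ (α) record, (O‴χₛ), `HistoryTailL`, the rung R3 is proved; the Yang–Mills mass gap is NOT proved.

References: T. Bałaban, CMP **102** (1985) 255–275 [Balaban1985UV3] ((47), (55) pp.268–270); LEAD note `Cruxes/HistoryTailL/HTopBranchExpansion.md`
§5–§6 (2026-08-30); dag-n08-d `N08-HJ-M3-SPEC-g47.md` §1 (read sets: the crossing bond is private; a read set meets only inner halves of
foreign segments).
-/

set_option autoImplicit false

namespace Summit.QuantumFields.YangMills.Theorems.UV3BranchExpansionCountingAmortizedLetters

open Finset

variable {β γ : Type*}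

/-! ## §1 Geometry of one blocking step: crossing bonds, side slots, read sets -/

section Geometry

variable [DecidableEq γ] (R line : β → Finset γ) (ctr : β → γ) {L r₀ ρ₀ : ℕ}

omit [DecidableEq γ] in
/-- The crossing-bond map is injective: `ctr g ∈ line g`, and distinct segments are disjoint. [folklore] -/
theorem ctr_injective (hctr : ∀ g, ctr g ∈ line g) (hdisj : ∀ g g', g ≠ g' → Disjoint (line g) (line g')) :
    Function.Injective ctr := by
  intro g g' h
  by_contra hne
  exact Finset.disjoint_left.mp (hdisj g g' hne) (hctr g) (h ▸ hctr g')

/-- `|ctr(G)| = |G|`. [folklore] -/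
theorem card_image_ctr (hctr : ∀ g, ctr g ∈ line g) (hdisj : ∀ g g', g ≠ g' → Disjoint (line g) (line g'))
    (G : Finset β) : (G.image ctr).card = G.card :=
  Finset.card_image_of_injective G (ctr_injective line ctr hctr hdisj)

/-- The side slots of distinct segments are disjoint. [folklore] -/
theorem pairwiseDisjoint_side (hdisj : ∀ g g', g ≠ g' → Disjoint (line g) (line g')) (G : Finset β) :
    (G : Set β).PairwiseDisjoint (fun g => (line g).erase (ctr g)) := by
  intro g _ g' _ hne
  exact Finset.disjoint_of_subset_left (Finset.erase_subset _ _)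
    (Finset.disjoint_of_subset_right (Finset.erase_subset _ _) (hdisj g g' hne))

/-- `|Side(G)| = (L − 1)·|G|` when every segment has exactly `L` bonds. [folklore] -/
theorem card_biUnion_side (hctr : ∀ g, ctr g ∈ line g) (hline : ∀ g, (line g).card = L)
    (hdisj : ∀ g g', g ≠ g' → Disjoint (line g) (line g')) (G : Finset β) :
    (G.biUnion (fun g => (line g).erase (ctr g))).card = (L - 1) * G.card := by
  rw [Finset.card_biUnion (pairwiseDisjoint_side line ctr hdisj G)]
  have : ∀ g ∈ G, ((line g).erase (ctr g)).card = L - 1 := fun g _ => by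
    rw [Finset.card_erase_of_mem (hctr g), hline g]
  rw [Finset.sum_congr rfl this, Finset.sum_const, smul_eq_mul, mul_comm]

/-- `ctr(G)` and `Side(G)` are disjoint. [folklore] -/
theorem disjoint_image_ctr_biUnion_side (hctr : ∀ g, ctr g ∈ line g)
    (hdisj : ∀ g g', g ≠ g' → Disjoint (line g) (line g')) (G : Finset β) :
    Disjoint (G.image ctr) (G.biUnion (fun g => (line g).erase (ctr g))) := by
  rw [Finset.disjoint_left]
  intro b hb hb'
  obtain ⟨g, hg, rfl⟩ := Finset.mem_image.mp hb
  obtain ⟨g', hg', hmem⟩ := Finset.mem_biUnion.mp hb'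
  by_cases hgg : g = g'
  · subst hgg; exact (Finset.notMem_erase _ _) hmem
  · exact Finset.disjoint_left.mp (hdisj g g' hgg) (hctr g) (Finset.mem_of_mem_erase hmem)

/-- `line(G) = ctr(G) ∪ Side(G)`. [folklore] -/
theorem biUnion_line_eq (hctr : ∀ g, ctr g ∈ line g) (G : Finset β) :
    G.biUnion line = G.image ctr ∪ G.biUnion (fun g => (line g).erase (ctr g)) := by
  ext b
  simp only [Finset.mem_biUnion, Finset.mem_union, Finset.mem_image, Finset.mem_erase]
  constructor
  · rintro ⟨g, hg, hb⟩
    by_cases h : b = ctr g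
    · exact Or.inl ⟨g, hg, h.symm⟩
    · exact Or.inr ⟨g, hg, h, hb⟩
  · rintro (⟨g, hg, rfl⟩ | ⟨g, hg, -, hb⟩)
    · exact ⟨g, hg, hctr g⟩
    · exact ⟨g, hg, hb⟩

/-- PRIVACY: the crossing bond of a segment that does not fire is read by no fired bond. [folklore] -/
theorem ctr_not_mem_biUnion_R (hpriv : ∀ g c, ctr g ∈ R c → c = g) {s : Finset β} {g : β} (hg : g ∉ s) :
    ctr g ∉ s.biUnion R := by
  intro h
  obtain ⟨c, hc, hmem⟩ := Finset.mem_biUnion.mp h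
  exact hg ((hpriv g c hmem) ▸ hc)

/-- `|R(s)| ≤ r₀·|s|`. [folklore] -/
theorem card_biUnion_R_le (hR : ∀ c, (R c).card ≤ r₀) (s : Finset β) : (s.biUnion R).card ≤ r₀ * s.card := by
  calc (s.biUnion R).card ≤ ∑ c ∈ s, (R c).card := Finset.card_biUnion_le
    _ ≤ ∑ _c ∈ s, r₀ := Finset.sum_le_sum (fun c _ => hR c)
    _ = r₀ * s.card := by rw [Finset.sum_const, smul_eq_mul, mul_comm]

/-- The readers of the side slots of `G`: `|N(G)| ≤ (L − 1)·ρ₀·|G|` when every lower bond is read by at most `ρ₀` upper bonds. [folklore] -/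
theorem card_N_le [Fintype β] [DecidableEq β] (hctr : ∀ g, ctr g ∈ line g) (hline : ∀ g, (line g).card = L)
    (hρ : ∀ b : γ, (Finset.univ.filter (fun c => b ∈ R c)).card ≤ ρ₀)
    (N : Finset β → Finset β) (hN : ∀ G c, c ∈ N G ↔ ∃ g ∈ G, ∃ b ∈ (line g).erase (ctr g), b ∈ R c)
    (G : Finset β) : (N G).card ≤ (L - 1) * ρ₀ * G.card := by
  have hsub : N G ⊆ G.biUnion (fun g => ((line g).erase (ctr g)).biUnion
      (fun b => Finset.univ.filter (fun c => b ∈ R c))) := by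
    intro c hc
    obtain ⟨g, hg, b, hb, hbc⟩ := (hN G c).mp hc
    exact Finset.mem_biUnion.mpr ⟨g, hg, Finset.mem_biUnion.mpr ⟨b, hb, by simpa using hbc⟩⟩
  calc (N G).card ≤ _ := Finset.card_le_card hsub
    _ ≤ ∑ g ∈ G, (((line g).erase (ctr g)).biUnion (fun b => Finset.univ.filter (fun c => b ∈ R c))).card :=
        Finset.card_biUnion_le
    _ ≤ ∑ g ∈ G, (L - 1) * ρ₀ := by
        refine Finset.sum_le_sum (fun g _ => ?_)
        calc _ ≤ ∑ b ∈ (line g).erase (ctr g), (Finset.univ.filter (fun c => b ∈ R c)).card := Finset.card_biUnion_le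
          _ ≤ ∑ _b ∈ (line g).erase (ctr g), ρ₀ := Finset.sum_le_sum (fun b _ => hρ b)
          _ = (L - 1) * ρ₀ := by rw [Finset.sum_const, smul_eq_mul, Finset.card_erase_of_mem (hctr g), hline g]
    _ = (L - 1) * ρ₀ * G.card := by rw [Finset.sum_const, smul_eq_mul]; ring

end Geometry

/-! ## §2 Powerset algebra: the explored-set sum -/

section Powerset

/-- `Σ_{T ⊆ S} D^{|T|} = (1 + D)^{|S|}`. [folklore] -/
theorem sum_powerset_pow_card (S : Finset γ) (D : ℝ) :
    ∑ T ∈ S.powerset, D ^ T.card = (1 + D) ^ S.card := by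
  have h := Finset.sum_pow_mul_eq_add_pow D (1 : ℝ) S
  simp only [one_pow, mul_one] at h
  rw [h, add_comm]

variable [DecidableEq γ]

/-- `Σ_{T ⊆ S} y^{|S ∖ T|}·D^{|T|} = (y + D)^{|S|}`. [folklore] -/
theorem sum_powerset_pow_sdiff_mul_pow (S : Finset γ) (y D : ℝ) :
    ∑ T ∈ S.powerset, y ^ (S \ T).card * D ^ T.card = (y + D) ^ S.card := by
  have h := Finset.sum_pow_mul_eq_add_pow D y S
  rw [add_comm] at h
  rw [← h]
  refine Finset.sum_congr rfl (fun T hT => ?_)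
  rw [Finset.card_sdiff_of_subset (Finset.mem_powerset.mp hT), mul_comm]

variable (line : β → Finset γ) (ctr : β → γ) {L : ℕ}

/-- ★★ **THE EXPLORED-SET SUM.**  For a set `G` of ghost segments and a set `Rs` of read bonds, summing `y^{|Side G ∖ X'|}·D^{|X'|}` over all
explored sets `X' ⊆ line(G) ∪ Rs` containing every crossing bond of `G` gives at most `D^{|G|}·(y + D)^{(L−1)|G|}·(1 + D)^{|Rs|}`:
the crossing slots are distorted (a factor `D` each), each side slot is distorted (`D`) or penalised (`y`), each read bond is distorted or not.
Proof: the injection `X' ↦ (X' ∩ Side G, X' ∖ line G)` into `𝒫(Side G) × 𝒫(Rs)` and the two binomial identities above. [folklore] -/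
theorem sum_explored_le (hctr : ∀ g, ctr g ∈ line g) (hline : ∀ g, (line g).card = L)
    (hdisj : ∀ g g', g ≠ g' → Disjoint (line g) (line g')) (G : Finset β) (Rs : Finset γ)
    {y D : ℝ} (hy : 0 ≤ y) (hD : 0 ≤ D) :
    ∑ X' ∈ (G.biUnion line ∪ Rs).powerset with G.image ctr ⊆ X',
        y ^ (G.biUnion (fun g => (line g).erase (ctr g)) \ X').card * D ^ X'.card
      ≤ D ^ G.card * (y + D) ^ ((L - 1) * G.card) * (1 + D) ^ Rs.card := by
  classical
  set SideG := G.biUnion (fun g => (line g).erase (ctr g)) with hSideG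
  set ctrG := G.image ctr with hctrG
  set lineG := G.biUnion line with hlineG
  set I := (lineG ∪ Rs).powerset.filter (fun X' => ctrG ⊆ X') with hI
  have hlineG_eq : lineG = ctrG ∪ SideG := biUnion_line_eq line ctr hctr G
  have hcs : Disjoint ctrG SideG := disjoint_image_ctr_biUnion_side line ctr hctr hdisj G
  -- the summand as a function of φ X' = (X' ∩ SideG, X' \ lineG)
  let φ : Finset γ → Finset γ × Finset γ := fun X' => (X' ∩ SideG, X' \ lineG)
  let gfun : Finset γ × Finset γ → ℝ := fun p => D ^ G.card * ((y ^ (SideG \ p.1).card * D ^ p.1.card) * D ^ p.2.card)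
  have hdecomp : ∀ X' ∈ I, X' = ctrG ∪ (X' ∩ SideG) ∪ (X' \ lineG) := by
    intro X' hX'
    have hsub : ctrG ⊆ X' := (Finset.mem_filter.mp hX').2
    ext b
    simp only [Finset.mem_union, Finset.mem_inter, Finset.mem_sdiff]
    constructor
    · intro hb
      by_cases hbl : b ∈ lineG
      · rw [hlineG_eq, Finset.mem_union] at hbl
        rcases hbl with h | h
        · exact Or.inl (Or.inl h)
        · exact Or.inl (Or.inr ⟨hb, h⟩)
      · exact Or.inr ⟨hb, hbl⟩
    · rintro ((h | ⟨h, -⟩) | ⟨h, -⟩)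
      · exact hsub h
      · exact h
      · exact h
  have hcard : ∀ X' ∈ I, X'.card = G.card + (X' ∩ SideG).card + (X' \ lineG).card := by
    intro X' hX'
    have h1 : Disjoint ctrG (X' ∩ SideG) := Finset.disjoint_of_subset_right Finset.inter_subset_right hcs
    have h2 : Disjoint (ctrG ∪ (X' ∩ SideG)) (X' \ lineG) := by
      rw [Finset.disjoint_left]
      intro b hb hb'
      have : b ∈ lineG := by
        rw [hlineG_eq, Finset.mem_union]
        rcases Finset.mem_union.mp hb with h | h
        · exact Or.inl h
        · exact Or.inr (Finset.mem_inter.mp h).2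
      exact (Finset.mem_sdiff.mp hb').2 this
    conv_lhs => rw [hdecomp X' hX']
    rw [Finset.card_union_of_disjoint h2, Finset.card_union_of_disjoint h1, hctrG,
      card_image_ctr line ctr hctr hdisj G]
  have hside : ∀ X' ∈ I, SideG \ X' = SideG \ (X' ∩ SideG) := by
    intro X' _
    ext b; simp only [Finset.mem_sdiff, Finset.mem_inter]; tauto
  have hfg : ∀ X' ∈ I, y ^ (SideG \ X').card * D ^ X'.card = gfun (φ X') := by
    intro X' hX'
    simp only [gfun, φ]
    rw [hcard X' hX', hside X' hX', pow_add, pow_add]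
    ring
  have hinj : Set.InjOn φ I := by
    intro X₁ h₁ X₂ h₂ heq
    simp only [φ, Prod.mk.injEq] at heq
    rw [hdecomp X₁ h₁, hdecomp X₂ h₂, heq.1, heq.2]
  have himg : I.image φ ⊆ SideG.powerset ×ˢ Rs.powerset := by
    intro p hp
    obtain ⟨X', hX', rfl⟩ := Finset.mem_image.mp hp
    simp only [φ, Finset.mem_product, Finset.mem_powerset]
    refine ⟨Finset.inter_subset_right, ?_⟩
    intro b hb
    have hbU : b ∈ lineG ∪ Rs := Finset.mem_powerset.mp (Finset.mem_filter.mp hX').1 (Finset.mem_sdiff.mp hb).1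
    rcases Finset.mem_union.mp hbU with h | h
    · exact absurd h (Finset.mem_sdiff.mp hb).2
    · exact h
  have hg0 : ∀ p ∈ SideG.powerset ×ˢ Rs.powerset, 0 ≤ gfun p := fun p _ => by positivity
  calc ∑ X' ∈ I, y ^ (SideG \ X').card * D ^ X'.card
      = ∑ X' ∈ I, gfun (φ X') := Finset.sum_congr rfl hfg
    _ = ∑ p ∈ I.image φ, gfun p := (Finset.sum_image hinj).symm
    _ ≤ ∑ p ∈ SideG.powerset ×ˢ Rs.powerset, gfun p :=
        Finset.sum_le_sum_of_subset_of_nonneg himg (fun p hp _ => hg0 p hp)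
    _ = D ^ G.card * ((∑ T ∈ SideG.powerset, y ^ (SideG \ T).card * D ^ T.card) *
          (∑ Rr ∈ Rs.powerset, D ^ Rr.card)) := by
        rw [Finset.sum_product, Finset.sum_mul_sum, Finset.mul_sum]
        refine Finset.sum_congr rfl (fun T _ => ?_)
        rw [Finset.mul_sum]
    _ = D ^ G.card * (y + D) ^ ((L - 1) * G.card) * (1 + D) ^ Rs.card := by
        rw [sum_powerset_pow_sdiff_mul_pow, sum_powerset_pow_card, hSideG,
          card_biUnion_side line ctr hctr hline hdisj G, mul_assoc]

end Powerset

end Summit.QuantumFields.YangMills.Theorems.UV3BranchExpansionCountingAmortizedLetters
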